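import Literature.Analysis.FluidPDE.PerturbedNSFourierPicard
import HarnessLib

/-!
# Picard iteration for the Fourier-transformed perturbed Navier–Stokes system: convergence, the limit

Analysis/FluidPDE proof file, sequel of `PerturbedNSFourierPicard` (the Duhamel map on the
order-four ball, the contraction by `1/2`, the threshold) in the chain `PerturbedNSFourier*`
proving short-time existence of smooth solutions of the perturbed Navier–Stokes system around
a smooth divergence-free background on `T^d`, `#d ≤ 3` (Majda–Bertozzi 2002, Thm. 3.4;
Cheskidov–Luo 2022, §3.1 (3.2)). Under the threshold hypotheses `BallHyp ν θ U a Z ρ A` the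
Picard iterates `c₀ = 0`, `cₙ₊₁ = Φ(cₙ)` of the mild equation converge on `[0, θ]` (Picard's
successive approximations; Leray 1934, §19, for the Navier–Stokes twin; Lemarié-Rieusset 2016,
§8.5, for the weighted sup-norms):

* `BallHyp.iter_estimates`, `BallHyp.iter_tendsto` — continuity of the iterates, the ball of
  radius `ρ` at order four, geometric convergence `‖cₙ₊₁ - cₙ‖ ≤ ρ 2^{-n} (1+‖k‖)^{-4}`;
* the limit `c = picardLim`: continuous in time (`continuous_picardLim`), in the ball
  (`hasDecay_picardLim`), the mild equation `c = Φ(c)` (`picardLim_eq_picardMap`) and the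
  datum `c(l, 0, k) = a(l, k)` (`picardLim_zero_time`).

Every polynomial decay, the symmetries and the time regularity of the limit are in the sequel
files.

## References

* A. J. Majda, A. L. Bertozzi, *Vorticity and Incompressible Flow*, CUP 2002, Thm. 3.4. [`MajdaBertozziCUP2002`]
* A. Cheskidov, X. Luo, arXiv:2009.06596, §3.1 (3.2). [`CheskidovLuo2022`]
* P. G. Lemarié-Rieusset, *The Navier–Stokes problem in the 21st century*, CRC 2016, §8.5.
* J. Leray, Acta Math. 63 (1934), §19. [`Leray1934`]
-/

noncomputable section

open MeasureTheory Real Set Filter Topology UnitAddTorus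

namespace Literature.Analysis.FluidPDE

namespace PerturbedNSFourier

open ScalarFourier
open CorrectorFourier (leraySym projSym)
open FourierNS (HasDecay clamp)
open Literature.Analysis.FunctionSpaces.Torus (freqNormSq)

variable {d : Type*} [Fintype d] [DecidableEq d]
variable {ν θ : ℝ} {U : d → ℝ → (d → ℤ) → ℂ} {a : d → (d → ℤ) → ℂ} {Z ρ A : ℝ}

/-! ### The iteration: geometric convergence in the order-four ball -/

section Iteration

/-- **The iteration estimates on a short interval.** Under the threshold hypotheses every
iterate `cₙ` is continuous in time, lies in the order-four ball of radius `ρ`, and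
`‖cₙ₊₁ - cₙ‖ ≤ ρ 2^{-n} (1+‖k‖)^{-4}` (induction on `n`: the ball is mapped to itself,
`BallHyp.hasDecay_picardMap`, and differences are halved, `BallHyp.hasDecay_picardMap_sub`). [folklore] -/
theorem BallHyp.iter_estimates (h : BallHyp ν θ U a Z ρ A) (n : ℕ) :
    (∀ l m, Continuous fun t => picardIter ν θ U a n l t m) ∧
    (∀ l t, HasDecay 4 ρ (picardIter ν θ U a n l t)) ∧
    (∀ l t, HasDecay 4 (ρ * (1 / 2) ^ n)
      (fun m => picardIter ν θ U a (n + 1) l t m - picardIter ν θ U a n l t m)) := by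
  have hρ := h.hρ
  induction n with
  | zero =>
    have hzero : ∀ l t, HasDecay 4 ρ (picardIter ν θ U a 0 l t) := by
      intro l t m; simp only [picardIter_zero, norm_zero]; positivity
    refine ⟨fun l m => ?_, hzero, fun l t => ?_⟩
    · simpa using continuous_const
    · have h1 := h.hasDecay_picardMap hzero l t
      simp only [picardIter_succ, picardIter_zero, sub_zero, pow_zero, mul_one]
      exact h1
  | succ n ih =>
    obtain ⟨hcont, hball, hdiff⟩ := ih
    have hcont' : ∀ l m, Continuous fun t => picardIter ν θ U a (n + 1) l t m := fun l m => by
      simp only [picardIter_succ]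
      exact h.continuous_picardMap hcont hball l m
    have hball' : ∀ l t, HasDecay 4 ρ (picardIter ν θ U a (n + 1) l t) := fun l t => by
      simp only [picardIter_succ]
      exact h.hasDecay_picardMap hball l t
    refine ⟨hcont', hball', fun l t => ?_⟩
    have key := h.hasDecay_picardMap_sub hcont' hcont hball' hball
      (by positivity : 0 ≤ ρ * (1 / 2) ^ n) hdiff l t
    simp only [picardIter_succ] at key ⊢
    exact key.mono (le_of_eq (by ring))

/-- **Convergence of the Picard iteration on a short interval with all estimates**: under the
threshold, the iterates are continuous in time and in the order-four ball of radius `ρ`,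
converge to `c = picardLim` with `‖cₙ - c‖ ≤ 2ρ 2^{-n} (1+‖k‖)^{-4}` uniformly in `(l, t)`,
and the limit lies in the ball (geometric series; Mathlib `cauchySeq_of_le_geometric`,
`dist_le_of_le_geometric_of_tendsto`). [folklore] -/
theorem BallHyp.iter_tendsto (h : BallHyp ν θ U a Z ρ A) :
    (∀ n l m, Continuous fun t => picardIter ν θ U a n l t m) ∧
    (∀ n l t, HasDecay 4 ρ (picardIter ν θ U a n l t)) ∧
    (∀ l t m, Tendsto (fun n => picardIter ν θ U a n l t m) atTop (𝓝 (picardLim ν θ U a l t m))) ∧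
    (∀ n l t, HasDecay 4 (2 * ρ * (1 / 2) ^ n)
      (fun m => picardIter ν θ U a n l t m - picardLim ν θ U a l t m)) ∧
    (∀ l t, HasDecay 4 ρ (picardLim ν θ U a l t)) := by
  have hest := h.iter_estimates
  have hstep : ∀ l t m n, dist (picardIter ν θ U a n l t m) (picardIter ν θ U a (n + 1) l t m) ≤
      ρ * ((1 + ‖m‖) ^ 4)⁻¹ * (1 / 2) ^ n := by
    intro l t m n
    rw [dist_eq_norm, norm_sub_rev]
    have h1 := (hest n).2.2 l t m
    calc _ ≤ ρ * (1 / 2) ^ n * ((1 + ‖m‖) ^ 4)⁻¹ := h1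
      _ = _ := by ring
  have hcauchy : ∀ l t m, CauchySeq fun n => picardIter ν θ U a n l t m := fun l t m =>
    cauchySeq_of_le_geometric (1 / 2) _ (by norm_num) (hstep l t m)
  have htend : ∀ l t m, Tendsto (fun n => picardIter ν θ U a n l t m) atTop
      (𝓝 (picardLim ν θ U a l t m)) := fun l t m => (hcauchy l t m).tendsto_limUnder
  have herr : ∀ n l t m, ‖picardIter ν θ U a n l t m - picardLim ν θ U a l t m‖ ≤
      2 * ρ * (1 / 2) ^ n * ((1 + ‖m‖) ^ 4)⁻¹ := by
    intro n l t m
    have h1 := dist_le_of_le_geometric_of_tendsto (1 / 2) _ (by norm_num) (hstep l t m) (htend l t m) n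
    rw [dist_eq_norm] at h1
    refine h1.trans_eq ?_
    ring
  refine ⟨fun n => (hest n).1, fun n => (hest n).2.1, htend, fun n l t m => herr n l t m, fun l t m => ?_⟩
  -- the limit stays in the closed ball
  refine le_of_tendsto ((continuous_norm.tendsto _).comp (htend l t m)) (Eventually.of_forall fun n => ?_)
  exact (hest n).2.1 l t m

/-- **The Picard limit is continuous in time** at each component and frequency (uniform limit
of continuous functions, Mathlib `TendstoUniformly.continuous`). [folklore] -/
theorem BallHyp.continuous_picardLim (h : BallHyp ν θ U a Z ρ A) (l : d) (m : d → ℤ) :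
    Continuous fun t => picardLim ν θ U a l t m := by
  obtain ⟨hcont, -, -, herr, -⟩ := h.iter_tendsto
  have hρ := h.hρ
  have hunif : TendstoUniformly (fun n t => picardIter ν θ U a n l t m)
      (fun t => picardLim ν θ U a l t m) atTop := by
    refine Metric.tendstoUniformly_iff.2 fun ε hε => ?_
    have hgeo : Tendsto (fun n : ℕ => 2 * ρ * (1 / 2 : ℝ) ^ n) atTop (𝓝 0) := by
      have := tendsto_pow_atTop_nhds_zero_of_lt_one (r := (1 / 2 : ℝ)) (by norm_num) (by norm_num)
      simpa using this.const_mul (2 * ρ)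
    filter_upwards [(tendsto_order.1 hgeo).2 ε hε] with n hn t
    rw [dist_comm, dist_eq_norm]
    have h1 := herr n l t m
    have hw : ((1 + ‖m‖) ^ 4)⁻¹ ≤ 1 := FourierNS.inv_one_add_norm_pow_le_one m _
    have h2ρ : 0 ≤ 2 * ρ * (1 / 2 : ℝ) ^ n := by positivity
    calc _ ≤ 2 * ρ * (1 / 2) ^ n * ((1 + ‖m‖) ^ 4)⁻¹ := h1
      _ ≤ 2 * ρ * (1 / 2) ^ n * 1 := mul_le_mul_of_nonneg_left hw h2ρ
      _ < ε := by rw [mul_one]; exact hn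
  exact hunif.continuous (Frequently.of_forall fun n => hcont n l m)

/-- **The Picard limit lies in the order-four ball of radius `ρ`.** [folklore] -/
theorem BallHyp.hasDecay_picardLim (h : BallHyp ν θ U a Z ρ A) (l : d) (t : ℝ) :
    HasDecay 4 ρ (picardLim ν θ U a l t) :=
  h.iter_tendsto.2.2.2.2 l t

/-- **The Picard limit is a fixed point of the Duhamel map on a short interval**: `c = Φ(c)`,
i.e. the mild equation
`c(l,t,k) = e^{-νₖτ} a(l,k) - ∫₀^τ e^{-νₖ(τ-s)} (P G)(U(s), 0, c(s))(l,k) ds`, `τ = clamp θ t`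
(`‖Φ(c) - c‖ ≤ ‖Φ(c) - Φ(cₙ)‖ + ‖cₙ₊₁ - c‖ → 0`). [folklore] -/
theorem BallHyp.picardLim_eq_picardMap (h : BallHyp ν θ U a Z ρ A) (l : d) (t : ℝ) (k : d → ℤ) :
    picardLim ν θ U a l t k = picardMap ν θ U a (picardLim ν θ U a) l t k := by
  obtain ⟨hcont, hball, -, herr, hlimball⟩ := h.iter_tendsto
  have hρ := h.hρ
  set c := picardLim ν θ U a with hc
  have hcc : ∀ l m, Continuous fun t => c l t m := h.continuous_picardLim
  have hbound : ∀ n : ℕ, ‖picardMap ν θ U a c l t k - c l t k‖ ≤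
      (1 / 2 * (2 * ρ * (1 / 2) ^ n) + 2 * ρ * (1 / 2) ^ (n + 1)) * ((1 + ‖k‖) ^ 4)⁻¹ := by
    intro n
    have hdiff : ∀ l t, HasDecay 4 (2 * ρ * (1 / 2) ^ n)
        (fun m => c l t m - picardIter ν θ U a n l t m) := by
      intro l t m
      have h1 := herr n l t m
      rwa [norm_sub_rev] at h1
    have key := h.hasDecay_picardMap_sub hcc (hcont n) hlimball (hball n) (by positivity) hdiff l t k
    rw [← picardIter_succ] at key
    have h2 := herr (n + 1) l t k
    calc ‖picardMap ν θ U a c l t k - c l t k‖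
        ≤ ‖picardMap ν θ U a c l t k - picardIter ν θ U a (n + 1) l t k‖ +
          ‖picardIter ν θ U a (n + 1) l t k - c l t k‖ := norm_sub_le_norm_sub_add_norm_sub _ _ _
      _ ≤ 1 / 2 * (2 * ρ * (1 / 2) ^ n) * ((1 + ‖k‖) ^ 4)⁻¹ +
          2 * ρ * (1 / 2) ^ (n + 1) * ((1 + ‖k‖) ^ 4)⁻¹ := add_le_add key h2
      _ = _ := by ring
  have hlim : Tendsto (fun n : ℕ => (1 / 2 * (2 * ρ * (1 / 2 : ℝ) ^ n) + 2 * ρ * (1 / 2) ^ (n + 1)) *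
      ((1 + ‖k‖) ^ 4)⁻¹) atTop (𝓝 0) := by
    have hg := tendsto_pow_atTop_nhds_zero_of_lt_one (r := (1 / 2 : ℝ)) (by norm_num) (by norm_num)
    have e : (fun n : ℕ => (1 / 2 * (2 * ρ * (1 / 2 : ℝ) ^ n) + 2 * ρ * (1 / 2) ^ (n + 1)) *
        ((1 + ‖k‖) ^ 4)⁻¹) = fun n => (2 * ρ * ((1 + ‖k‖) ^ 4)⁻¹) * (1 / 2 : ℝ) ^ n := by
      funext n; ring
    rw [e]
    simpa using hg.const_mul (2 * ρ * ((1 + ‖k‖) ^ 4)⁻¹)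
  have h0 : ‖picardMap ν θ U a c l t k - c l t k‖ ≤ 0 := ge_of_tendsto' hlim fun n => hbound n
  have := norm_le_zero_iff.1 h0
  rw [sub_eq_zero] at this
  exact this.symm

/-- The Duhamel map at time `0` returns the datum: `Φ(c)(l, 0, k) = a(l, k)`. [folklore] -/
theorem picardMap_zero_time (hθ : 0 ≤ θ) (c : d → ℝ → (d → ℤ) → ℂ) (l : d) (k : d → ℤ) :
    picardMap ν θ U a c l 0 k = a l k := by
  simp [picardMap, FourierNS.clamp_zero hθ]

/-- **The Picard limit attains the datum**: `c(l, 0, k) = a(l, k)`. [folklore] -/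
theorem BallHyp.picardLim_zero_time (h : BallHyp ν θ U a Z ρ A) (l : d) (k : d → ℤ) :
    picardLim ν θ U a l 0 k = a l k := by
  rw [h.picardLim_eq_picardMap l 0 k, picardMap_zero_time h.hθ.le]

end Iteration

end PerturbedNSFourier

end Literature.Analysis.FluidPDE

end
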